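import Literature.NumberTheory.EllipticCurves.DivisionPointsKernelMembership
import Literature.NumberTheory.EllipticCurves.DeShalitThetaTExpansionColemanBridgeFamily
import Literature.NumberTheory.EllipticCurves.DivisionPointsLaneCoherence
import Literature.NumberTheory.ComplexMultiplication.EllipticUnits.DeShalitDivisionPointsLatticeGeneral
import Summits.BirchSwinnertonDyer.BirchSwinnertonDyer.Theorems.PrintCf2RubinValueTwoKatzMeasureJZeroSeamPerUnitValues
import HarnessLib

/-!
# (hβ_i) for a family of units reading theta values, with the Tate unit EXPOSED and (N1) DISCHARGED (brick B10f-e; proofs only)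

Cell `bsd-print-cf2`, width seat `bsd-line-cf2c-w4` g16.  Same assembly as `PerUnitBridgeFamily` (B10f-d,
`exists_unit_forall_relColemanSeries_eq_subst_subst_of_thetaReadings`) on the integer model `W = [1, −1, 0, −2, −1]` (`hW`), with two changes
asked for by the consumers of the j = 0 seam (cf2-p1-w8's V1, cf2-p1-w2's TATE-UNIT-LT / OQ-A1):
* (N1) `hU` («`ι_v ξ(u_{m+1}) ∈ E₁(E·K_π^{m+1})`») is DISCHARGED by cf2-p1-w5's
  `DivisionPointsKernelMembership.some_mem_kernel_divisionPt_of_readings`; its inputs are the four READING FAMILIES per level `m`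
  (`Y`: `ξ(u_{N+1})`, `S`: `ξ(k·u_{N+1} + ub)`, `W`: `ξ(Ω + (k·u_{N+1} + ub))`, `Z`: `ξ(π₀(Ω + (k·u_{N+1} + ub)))`, `N ≤ m`, all `k`; `ub` a
  `𝔭̄`-division point: `ι(π₁)ub ∈ L`, `ub ∉ L`), `π₀ + π₁ = 1` and `2^k ∉ 𝔪`; the readings of `ξ(u_{m+1})` are the diagonal `N = m` of `Y`
  (at `F = K_v` all readings come from `DivisionPointReadings[AtLevel]`; `[hEll]` is `isElliptic_curveOver_map_map`, `Δ(W) = −343`);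
* the Tate unit `a` is EXPOSED WITH ITS POINT PROPERTY — B10a's conclusion
  (`FormalGroupLubinTateDivisionPointsTateUnit.exists_unit_forall_ptOfZ_hom_hom_cohPt_eq`) VERBATIM for the points `(X^Y_{m,m}, Y^Y_{m,m})`,
  so that uniqueness / transport of `a` across levels can be applied downstream.

★★★ `exists_tateUnit_forall_relColemanSeries_eq_subst_subst_of_readings`:
**`∃ a ∈ 𝒪_Fˣ, (∀ m, P(h([a]ω_{m+1})) = ι_vξ(u_{m+1})) ∧ ∀ i, g_{β_i} = (Q_{R,i}^ψ ∘ [1]_{P′,f}) ∘ [a]_f`.**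
No summit statement is proved; BSD is not proved by any of this.

## References
* [deShalit1987] E. de Shalit, *Iwasawa theory of elliptic curves with complex multiplication* (1987), I §2.2 Theorem, II §4.4 (iv), (12),
  II §4.9 (23)–(24) and Proposition (ii) (p. 62–63), II §4.14 (38).
* [SilvermanAEC2009] J. H. Silverman, *The Arithmetic of Elliptic Curves*, 2nd ed. (2009), III.2.3, VI.3.6 (b), VII.2.1–VII.2.2.
-/
-- the summit namespace `Summit.BirchSwinnertonDyer.BirchSwinnertonDyer` repeats the problem name by design (D-0017)
set_option linter.dupNamespace false
set_option autoImplicit false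

noncomputable section

open scoped Classical
open scoped NumberField
open PeriodPair Literature.NumberTheory.EllipticCurves
open Literature.NumberTheory.ComplexMultiplication.EllipticUnits
open NumberField Field IsDedekindDomain IsDedekindDomain.HeightOneSpectrum ValuativeRel PowerSeries
open Literature.NumberTheory.NumberFields
open Literature.NumberTheory.GaloisRepresentations Literature.NumberTheory.GaloisRepresentations.IsNonarchimedeanLocalField
  Literature.NumberTheory.GaloisRepresentations.LubinTate Literature.NumberTheory.EllipticCurves.FormalGroupChart _root_.WeierstrassCurve

namespace Summit.BirchSwinnertonDyer.BirchSwinnertonDyer.Theorems.PrintCf2.KatzMeasureJZeroSeam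

attribute [local instance] ltNormUniformSpace ltNormIsUniformAddGroup rk1 nF nE fintypeResidueField

variable {K : Type} [Field K] [NumberField K] {𝔪 : Ideal (𝓞 K)} {v : HeightOneSpectrum (𝓞 K)}

/-- `‖2‖ < 1` in any finite `M/F` when the residue field of `F` has two elements (`2 ∈ π𝒪_M`). [cite: deShalit1987, I §3.12] -/
private theorem valuation_two_lt_one {F : Type} [Field F] [ValuativeRel F] [TopologicalSpace F] [IsNonarchimedeanLocalField F]
    (hq : residueFieldCard F = 2) {π : 𝒪[F]} (hπ : (valuation F).IsUniformizer (π : F))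
    (M : IntermediateField F (AlgebraicClosure F)) [FiniteDimensional F M] :
    NormedField.valuation (K := M) 2 < 1 := by
  obtain ⟨c, hc⟩ := Ideal.mem_span_singleton'.mp (two_mem_span_algebraMap_pi hπ M hq)
  have e2 : (2 : M) = ((c : unitBall M) : M) * ((algebraMap 𝒪[F] (unitBall M) π : unitBall M) : M) := by
    rw [← Subring.coe_mul, hc]; rfl
  change ‖(2 : M)‖₊ < 1
  rw [← NNReal.coe_lt_coe, coe_nnnorm, NNReal.coe_one, e2, norm_mul]
  calc ‖((c : unitBall M) : M)‖ * ‖((algebraMap 𝒪[F] (unitBall M) π : unitBall M) : M)‖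
      ≤ 1 * ‖((algebraMap 𝒪[F] (unitBall M) π : unitBall M) : M)‖ :=
        mul_le_mul_of_nonneg_right ((mem_unitBall_iff M).mp c.2) (norm_nonneg _)
    _ < 1 := by rw [one_mul]; exact norm_algebraMap_pi_lt_one hπ M

/-- ★★★ **(hβ_i) from readings with the Tate unit exposed and (N1) discharged**:
`∃ a ∈ 𝒪_Fˣ, (∀ m, P(h_{P′,f}([a]_f ω_{m+1})) = ι_vξ(u_{m+1})) ∧ ∀ i, g_{β_i} = (Q_{R,i}^ψ ∘ [1]_{P′,f}) ∘ [a]_f` for units `β_i ∈ 𝒰_E` whose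
components read the theta values `Θ(1; 𝔪v^{m+1}, 𝔞_i)`, on the model `W = [1, −1, 0, −2, −1]` — B10f-d with (N1) supplied by
`some_mem_kernel_divisionPt_of_readings` from the four reading families and B10a's point property of `a` kept in the conclusion
(see the module docstring). [cite: deShalit1987, I §2.2 Theorem, II §4.4 (iv), II §4.9 (23)–(24), Proposition (ii), II §4.14 (38)]
[cite: SilvermanAEC2009, III.2.3, VI.3.6 (b), VII.2.1–VII.2.2] -/
theorem exists_tateUnit_forall_relColemanSeries_eq_subst_subst_of_readings
    -- the lane: a local field `F` with `e : 𝒪_F ≃ ℤ₂`, a uniformizer `π` with `e π = π_ℤ`, the ordinary `ℤ₂`-datum of the integer model `W`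
    {F : Type} [Field F] [ValuativeRel F] [TopologicalSpace F] [IsNonarchimedeanLocalField F]
    (e : 𝒪[F] ≃+* ℤ_[2]) (hq : residueFieldCard F = 2)
    {π : 𝒪[F]} (hπ : (valuation F).IsUniformizer (π : F))
    {πZ : ℤ_[2]} (heπ : e π = πZ) (hA : IsLTRing πZ 2) {P : PowerSeries ℤ_[2]} (hP : IsLTSeries πZ 2 P) (W : WeierstrassCurve ℤ)
    (hW : W = ⟨1, -1, 0, -2, -1⟩) (hV : (W.map (Int.castRingHom ℤ_[2])).formalGroupLaw = ltF hA hP) {ϖ : ℤ_[2]} (hp : ((2 : ℕ) : ℤ_[2]) = ϖ * πZ) (hϖ : IsUnit ϖ)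
    (E : IntermediateField F (AlgebraicClosure F))
    [FiniteDimensional F E] [Normal F E] [IsGalois F E]
    (hE : E ≤ maxUnramified F) {σ₀ : absoluteGaloisGroup F} (hσ₀ : IsAbsArithFrob σ₀)
    [hEll : ∀ m : ℕ, (curveOver (E ⊔ ltField π m : IntermediateField F (AlgebraicClosure F))
      ((W.map (Int.castRingHom ℤ_[2])).map ((LTCoeff.of F).toRingHom.comp e.symm.toRingHom))).IsElliptic]
    -- the units `β_i ∈ 𝒰_E` whose components READ the theta values `Θ(1; 𝔪v^{m+1}, 𝔞_i)` (`β_i = ofGlobalUnits (ellipticUnitsGlobal …)`)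
    (ι : K →+* ℂ) (ιv : AlgebraicClosure K →+* AlgebraicClosure F) (h𝔪1 : 𝔪 ≠ ⊤)
    {J : Type*} (β : J → RelNormCoherentUnits hπ E) (𝔞 : J → Ideal (𝓞 K)) (xf : J → ∀ m : ℕ, rayClassField K (𝔪 * v.asIdeal ^ (m + 1)))
    (hxf : ∀ i m, IsThetaValueOne ι (𝔪 * v.asIdeal ^ (m + 1)) (𝔞 i)
      (algClosureEmb ι ((xf i m : rayClassField K (𝔪 * v.asIdeal ^ (m + 1))) : AlgebraicClosure K)))
    (hβv : ∀ (i : J) (m : ℕ), (((((β i).val m : unitBall (E ⊔ ltField π m : IntermediateField F (AlgebraicClosure F))) :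
        (E ⊔ ltField π m : IntermediateField F (AlgebraicClosure F))) : AlgebraicClosure F)) =
      ιv ((xf i m : rayClassField K (𝔪 * v.asIdeal ^ (m + 1))) : AlgebraicClosure K))
    -- the split prime: `v = (π₀)`, `2 = π₀π₁`, `π₀ + π₁ = 1`, `π₀` prime, `π₀ ∤ π₁`, `2ᵏ ∉ 𝔪`; `β_K π₀ ≡ 1 (mod 𝔪)`
    {π₀ π₁ βK : 𝓞 K} (hv0 : v.asIdeal = Ideal.span {π₀}) (h2K : (2 : 𝓞 K) = π₀ * π₁) (htr : π₀ + π₁ = 1) (hprime : Prime π₀)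
    (hπ₁ : ¬ π₀ ∣ π₁) (h𝔪2 : ∀ k : ℕ, ((2 : 𝓞 K) ^ k : 𝓞 K) ∉ 𝔪) (hβK : βK * π₀ - 1 ∈ 𝔪)
    -- the model lattice `L = Ω·ι(𝔪)` of `W ⊗ ℂ`; per unit `L′_i = 𝔞_i⁻¹L` with representatives `S_i`
    (L : PeriodPair) (La : J → PeriodPair) (S : J → Finset ℂ) {Ω : ℂ} (hS : ∀ i, L.IsLatticeReps (La i) (S i))
    (hLa : ∀ i, (La i).lattice = idealInvLattice ι (𝔞 i) L.lattice)
    (hL : ∀ z : ℂ, z ∈ L.lattice ↔ ∃ a ∈ 𝔪, z = Ω * ι (a : K)) (hΩ : Ω ≠ 0)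
    (h₂ : L.g₂ = (W.baseChange ℂ).c₄ / 12) (h₃ : L.g₃ = (W.baseChange ℂ).c₆ / 216)
    -- a `𝔭̄`-division point `ub` of `ℂ/L` (`ι(π₁)ub ∈ L`, `ub ∉ L`)
    {ub : ℂ} (hub1 : ι (π₁ : K) * ub ∈ L.lattice) (hub0 : ub ∉ L.lattice)
    -- the theta datum over `R`, read `𝔓`-adically by `ψ` and algebraically by `j`
    {R : Type*} [CommRing R] (ψ : R →+* unitBall E) (j : R →+* AlgebraicClosure K)
    (hψj : ∀ r : R, ((((ψ r : unitBall E) : E) : AlgebraicClosure F)) = ιv (j r))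
    (x₀ y₀ x₁ y₁ αR : R) (Kc : J → R) (x : J → ℂ → R) (uc : J → ℂ → Rˣ) (hu : ∀ i, ∀ c ∈ (S i).erase 0, (uc i c : R) = x₀ - x i c)
    (hKj : ∀ i, algClosureEmb ι (j (Kc i)) = L.deltaRatio (La i) * (L.g₂ ^ 3 - 27 * L.g₃ ^ 2) ^ ((S i).card - 1))
    (hxj : ∀ i, ∀ c ∈ (S i).erase 0, algClosureEmb ι (j (x i c)) = ℘[L] c - (W.baseChange ℂ).b₂ / 12)
    (hx₀ : algClosureEmb ι (j x₀) = ℘[L] Ω - (W.baseChange ℂ).b₂ / 12)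
    (hy₀ : algClosureEmb ι (j y₀) = (℘'[L] Ω - (W.baseChange ℂ).a₁ * (℘[L] Ω - (W.baseChange ℂ).b₂ / 12) - (W.baseChange ℂ).a₃) / 2)
    (hx₁ : algClosureEmb ι (j x₁) = ℘[L] (ι (π₀ : K) * Ω) - (W.baseChange ℂ).b₂ / 12)
    (hy₁ : algClosureEmb ι (j y₁) = (℘'[L] (ι (π₀ : K) * Ω) - (W.baseChange ℂ).a₁ * (℘[L] (ι (π₀ : K) * Ω) - (W.baseChange ℂ).b₂ / 12) -
      (W.baseChange ℂ).a₃) / 2)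
    (hαj : algClosureEmb ι (j αR) = ι (π₀ : K))
    (τ : R →+* R) (hτ : ((frobUnitBall E σ₀).symm : unitBall E →+* unitBall E).comp ψ = ψ.comp τ) (hKτ : ∀ i, τ (Kc i) = Kc i)
    (eι : J → ℂ → ℂ) (heT : ∀ i, ∀ c ∈ (S i).erase 0, eι i c ∈ (S i).erase 0) (hinj : ∀ i, Set.InjOn (eι i) ((S i).erase 0 : Finset ℂ))
    (hsurj : ∀ i, Set.SurjOn (eι i) ((S i).erase 0 : Finset ℂ) ((S i).erase 0 : Finset ℂ))
    (hxτ : ∀ i, ∀ c ∈ (S i).erase 0, τ (x i c) = x i (eι i c))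
    (hτx₀ : ∀ m : ℕ, algClosureEmb ι (j (τ^[m + 1] x₀)) = ℘[L] (ι ((βK ^ (m + 1) : 𝓞 K) : K) * Ω) - (W.baseChange ℂ).b₂ / 12)
    (hτy₀ : ∀ m : ℕ, algClosureEmb ι (j (τ^[m + 1] y₀)) = (℘'[L] (ι ((βK ^ (m + 1) : 𝓞 K) : K) * Ω) -
      (W.baseChange ℂ).a₁ * (℘[L] (ι ((βK ^ (m + 1) : 𝓞 K) : K) * Ω) - (W.baseChange ℂ).b₂ / 12) - (W.baseChange ℂ).a₃) / 2)
    -- the formal CM action over `R`, the transformation pair and its re-centred `R`-lifts, the series identities over `R`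
    {T : PowerSeries R} (hT0 : PowerSeries.constantCoeff T = 0)
    (hTP : T.map ψ = (P.map ((LTCoeff.of F).toRingHom.comp e.symm.toRingHom)).map
      (algebraMap (LTCoeff F) (unitBall E)))
    {PC QC : Polynomial ℂ}
    (hT : ∀ z : ℂ, z ∉ L.lattice → ι (π₀ : K) * z ∉ L.lattice → PC.eval (℘[L] z) = ℘[L] (ι (π₀ : K) * z) * QC.eval (℘[L] z))
    (hQC : ∀ z : ℂ, z ∉ L.lattice → ι (π₀ : K) * z ∉ L.lattice → QC.eval (℘[L] z) ≠ 0)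
    {Pr Qr : Polynomial R} {s : ℂ} (hs : s ≠ 0)
    (hQr : Qr.map ((algClosureEmb ι).comp j) = Polynomial.C s * QC.comp (Polynomial.X + Polynomial.C ((W.baseChange ℂ).b₂ / 12)))
    (hPr : Pr.map ((algClosureEmb ι).comp j) = Polynomial.C s * (PC.comp (Polynomial.X + Polynomial.C ((W.baseChange ℂ).b₂ / 12)) -
      Polynomial.C ((W.baseChange ℂ).b₂ / 12) * QC.comp (Polynomial.X + Polynomial.C ((W.baseChange ℂ).b₂ / 12))))
    (hidX : (((W.map (Int.castRingHom R)).translateX x₁ y₁).subst T + C (0 : R)) *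
        Polynomial.aeval ((W.map (Int.castRingHom R)).translateX x₀ y₀ + C (0 : R)) Qr =
      Polynomial.aeval ((W.map (Int.castRingHom R)).translateX x₀ y₀ + C (0 : R)) Pr)
    (hidY : C αR * (2 * PowerSeries.subst T ((W.map (Int.castRingHom R)).translateY x₁ y₁) +
            C (W.map (Int.castRingHom R)).a₁ * PowerSeries.subst T ((W.map (Int.castRingHom R)).translateX x₁ y₁) +
            C (W.map (Int.castRingHom R)).a₃) *
          Polynomial.aeval ((W.map (Int.castRingHom R)).translateX x₀ y₀ + C (0 : R)) Qr +
        (PowerSeries.subst T ((W.map (Int.castRingHom R)).translateX x₁ y₁) + C (0 : R)) *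
          Polynomial.aeval ((W.map (Int.castRingHom R)).translateX x₀ y₀ + C (0 : R)) (Polynomial.derivative Qr) *
          (2 * (W.map (Int.castRingHom R)).translateY x₀ y₀ +
            C (W.map (Int.castRingHom R)).a₁ * (W.map (Int.castRingHom R)).translateX x₀ y₀ + C (W.map (Int.castRingHom R)).a₃) =
      Polynomial.aeval ((W.map (Int.castRingHom R)).translateX x₀ y₀ + C (0 : R)) (Polynomial.derivative Pr) *
        (2 * (W.map (Int.castRingHom R)).translateY x₀ y₀ +
          C (W.map (Int.castRingHom R)).a₁ * (W.map (Int.castRingHom R)).translateX x₀ y₀ + C (W.map (Int.castRingHom R)).a₃))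
    -- LEVELWISE readings of `ξ(Ω/π₀^{m+1})` in `M_m`, of `ξ(Ω + u_{m+2})`, `ξ(π₀(Ω + u_{m+2}))` in `M_{m+1}`, through `K̄`
    (xq yq xw yw xz yz : ℕ → AlgebraicClosure K)
    (hxq : ∀ m : ℕ, algClosureEmb ι (xq m) = ℘[L] (Ω / ι ((π₀ ^ (m + 1) : 𝓞 K) : K)) - (W.baseChange ℂ).b₂ / 12)
    (hyq : ∀ m : ℕ, algClosureEmb ι (yq m) = (℘'[L] (Ω / ι ((π₀ ^ (m + 1) : 𝓞 K) : K)) -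
      (W.baseChange ℂ).a₁ * (℘[L] (Ω / ι ((π₀ ^ (m + 1) : 𝓞 K) : K)) - (W.baseChange ℂ).b₂ / 12) - (W.baseChange ℂ).a₃) / 2)
    (hxw : ∀ m : ℕ, algClosureEmb ι (xw m) =
      ℘[L] (Ω + (ι ((βK ^ (m + 2) : 𝓞 K) : K) * Ω - Ω / ι ((π₀ ^ (m + 2) : 𝓞 K) : K))) - (W.baseChange ℂ).b₂ / 12)
    (hyw : ∀ m : ℕ, algClosureEmb ι (yw m) = (℘'[L] (Ω + (ι ((βK ^ (m + 2) : 𝓞 K) : K) * Ω - Ω / ι ((π₀ ^ (m + 2) : 𝓞 K) : K))) -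
      (W.baseChange ℂ).a₁ * (℘[L] (Ω + (ι ((βK ^ (m + 2) : 𝓞 K) : K) * Ω - Ω / ι ((π₀ ^ (m + 2) : 𝓞 K) : K))) -
        (W.baseChange ℂ).b₂ / 12) - (W.baseChange ℂ).a₃) / 2)
    (hxz : ∀ m : ℕ, algClosureEmb ι (xz m) =
      ℘[L] (ι (π₀ : K) * (Ω + (ι ((βK ^ (m + 2) : 𝓞 K) : K) * Ω - Ω / ι ((π₀ ^ (m + 2) : 𝓞 K) : K)))) - (W.baseChange ℂ).b₂ / 12)
    (hyz : ∀ m : ℕ, algClosureEmb ι (yz m) =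
      (℘'[L] (ι (π₀ : K) * (Ω + (ι ((βK ^ (m + 2) : 𝓞 K) : K) * Ω - Ω / ι ((π₀ ^ (m + 2) : 𝓞 K) : K)))) -
        (W.baseChange ℂ).a₁ * (℘[L] (ι (π₀ : K) * (Ω + (ι ((βK ^ (m + 2) : 𝓞 K) : K) * Ω - Ω / ι ((π₀ ^ (m + 2) : 𝓞 K) : K)))) -
          (W.baseChange ℂ).b₂ / 12) - (W.baseChange ℂ).a₃) / 2)
    (XQ YQ : ∀ m : ℕ, ↥(E ⊔ ltField π m : IntermediateField F (AlgebraicClosure F)))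
    (XW YW XZ YZ : ∀ m : ℕ, ↥(E ⊔ ltField π (m + 1) : IntermediateField F (AlgebraicClosure F)))
    (hXQ : ∀ m, ((XQ m : ↥(E ⊔ ltField π m : IntermediateField F (AlgebraicClosure F))) : AlgebraicClosure F) = ιv (xq m))
    (hYQ : ∀ m, ((YQ m : ↥(E ⊔ ltField π m : IntermediateField F (AlgebraicClosure F))) : AlgebraicClosure F) = ιv (yq m))
    (hXW : ∀ m, ((XW m : ↥(E ⊔ ltField π (m + 1) : IntermediateField F (AlgebraicClosure F))) : AlgebraicClosure F) = ιv (xw m))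
    (hYW : ∀ m, ((YW m : ↥(E ⊔ ltField π (m + 1) : IntermediateField F (AlgebraicClosure F))) : AlgebraicClosure F) = ιv (yw m))
    (hXZ : ∀ m, ((XZ m : ↥(E ⊔ ltField π (m + 1) : IntermediateField F (AlgebraicClosure F))) : AlgebraicClosure F) = ιv (xz m))
    (hYZ : ∀ m, ((YZ m : ↥(E ⊔ ltField π (m + 1) : IntermediateField F (AlgebraicClosure F))) : AlgebraicClosure F) = ιv (yz m))
    -- the four READING FAMILIES of (N1)-PKG, per level `m` (`N ≤ m`, all `k`): `Y`: `ξ(u_{N+1})`, `S`: `ξ(k·u_{N+1} + ub)`,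
    -- `W`: `ξ(Ω + (k·u_{N+1} + ub))`, `Z`: `ξ(π₀(Ω + (k·u_{N+1} + ub)))`; the diagonal `N = m` of `Y` reads `ξ(u_{m+1})` in `M_m`
    (xY yY : ℕ → ℕ → AlgebraicClosure K) (XY YY : ∀ m : ℕ, ℕ → ↥(E ⊔ ltField π m : IntermediateField F (AlgebraicClosure F)))
    (hxY : ∀ m : ℕ, ∀ N ≤ m, algClosureEmb ι (xY m N) = ℘[L] ((ι ((βK ^ (N + 1) : 𝓞 K) : K) * Ω - Ω / ι ((π₀ ^ (N + 1) : 𝓞 K) : K))) - (W.baseChange ℂ).b₂ / 12)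
    (hyY : ∀ m : ℕ, ∀ N ≤ m, algClosureEmb ι (yY m N) =
      (℘'[L] ((ι ((βK ^ (N + 1) : 𝓞 K) : K) * Ω - Ω / ι ((π₀ ^ (N + 1) : 𝓞 K) : K))) - (W.baseChange ℂ).a₁ * (℘[L] ((ι ((βK ^ (N + 1) : 𝓞 K) : K) * Ω - Ω / ι ((π₀ ^ (N + 1) : 𝓞 K) : K))) - (W.baseChange ℂ).b₂ / 12) - (W.baseChange ℂ).a₃) / 2)
    (hXY : ∀ m : ℕ, ∀ N ≤ m, ((XY m N : ↥(E ⊔ ltField π m : IntermediateField F (AlgebraicClosure F))) : AlgebraicClosure F) = ιv (xY m N))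
    (hYY : ∀ m : ℕ, ∀ N ≤ m, ((YY m N : ↥(E ⊔ ltField π m : IntermediateField F (AlgebraicClosure F))) : AlgebraicClosure F) = ιv (yY m N))
    (xS yS : ℕ → ℕ → ℕ → AlgebraicClosure K) (XS YS : ∀ m : ℕ, ℕ → ℕ → ↥(E ⊔ ltField π m : IntermediateField F (AlgebraicClosure F)))
    (hxS : ∀ m : ℕ, ∀ N ≤ m, ∀ k : ℕ, algClosureEmb ι (xS m N k) = ℘[L] ((k : ℂ) * (ι ((βK ^ (N + 1) : 𝓞 K) : K) * Ω - Ω / ι ((π₀ ^ (N + 1) : 𝓞 K) : K)) + ub) - (W.baseChange ℂ).b₂ / 12)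
    (hyS : ∀ m : ℕ, ∀ N ≤ m, ∀ k : ℕ, algClosureEmb ι (yS m N k) =
      (℘'[L] ((k : ℂ) * (ι ((βK ^ (N + 1) : 𝓞 K) : K) * Ω - Ω / ι ((π₀ ^ (N + 1) : 𝓞 K) : K)) + ub) - (W.baseChange ℂ).a₁ * (℘[L] ((k : ℂ) * (ι ((βK ^ (N + 1) : 𝓞 K) : K) * Ω - Ω / ι ((π₀ ^ (N + 1) : 𝓞 K) : K)) + ub) - (W.baseChange ℂ).b₂ / 12) - (W.baseChange ℂ).a₃) / 2)
    (hXS : ∀ m : ℕ, ∀ N ≤ m, ∀ k : ℕ, ((XS m N k : ↥(E ⊔ ltField π m : IntermediateField F (AlgebraicClosure F))) : AlgebraicClosure F) = ιv (xS m N k))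
    (hYS : ∀ m : ℕ, ∀ N ≤ m, ∀ k : ℕ, ((YS m N k : ↥(E ⊔ ltField π m : IntermediateField F (AlgebraicClosure F))) : AlgebraicClosure F) = ιv (yS m N k))
    (xW' yW' : ℕ → ℕ → ℕ → AlgebraicClosure K) (XW' YW' : ∀ m : ℕ, ℕ → ℕ → ↥(E ⊔ ltField π m : IntermediateField F (AlgebraicClosure F)))
    (hxW' : ∀ m : ℕ, ∀ N ≤ m, ∀ k : ℕ, algClosureEmb ι (xW' m N k) = ℘[L] (Ω + ((k : ℂ) * (ι ((βK ^ (N + 1) : 𝓞 K) : K) * Ω - Ω / ι ((π₀ ^ (N + 1) : 𝓞 K) : K)) + ub)) - (W.baseChange ℂ).b₂ / 12)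
    (hyW' : ∀ m : ℕ, ∀ N ≤ m, ∀ k : ℕ, algClosureEmb ι (yW' m N k) =
      (℘'[L] (Ω + ((k : ℂ) * (ι ((βK ^ (N + 1) : 𝓞 K) : K) * Ω - Ω / ι ((π₀ ^ (N + 1) : 𝓞 K) : K)) + ub)) - (W.baseChange ℂ).a₁ * (℘[L] (Ω + ((k : ℂ) * (ι ((βK ^ (N + 1) : 𝓞 K) : K) * Ω - Ω / ι ((π₀ ^ (N + 1) : 𝓞 K) : K)) + ub)) - (W.baseChange ℂ).b₂ / 12) - (W.baseChange ℂ).a₃) / 2)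
    (hXW' : ∀ m : ℕ, ∀ N ≤ m, ∀ k : ℕ, ((XW' m N k : ↥(E ⊔ ltField π m : IntermediateField F (AlgebraicClosure F))) : AlgebraicClosure F) = ιv (xW' m N k))
    (hYW' : ∀ m : ℕ, ∀ N ≤ m, ∀ k : ℕ, ((YW' m N k : ↥(E ⊔ ltField π m : IntermediateField F (AlgebraicClosure F))) : AlgebraicClosure F) = ιv (yW' m N k))
    (xZ' yZ' : ℕ → ℕ → ℕ → AlgebraicClosure K) (XZ' YZ' : ∀ m : ℕ, ℕ → ℕ → ↥(E ⊔ ltField π m : IntermediateField F (AlgebraicClosure F)))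
    (hxZ' : ∀ m : ℕ, ∀ N ≤ m, ∀ k : ℕ, algClosureEmb ι (xZ' m N k) = ℘[L] (ι (π₀ : K) * (Ω + ((k : ℂ) * (ι ((βK ^ (N + 1) : 𝓞 K) : K) * Ω - Ω / ι ((π₀ ^ (N + 1) : 𝓞 K) : K)) + ub))) - (W.baseChange ℂ).b₂ / 12)
    (hyZ' : ∀ m : ℕ, ∀ N ≤ m, ∀ k : ℕ, algClosureEmb ι (yZ' m N k) =
      (℘'[L] (ι (π₀ : K) * (Ω + ((k : ℂ) * (ι ((βK ^ (N + 1) : 𝓞 K) : K) * Ω - Ω / ι ((π₀ ^ (N + 1) : 𝓞 K) : K)) + ub))) - (W.baseChange ℂ).a₁ * (℘[L] (ι (π₀ : K) * (Ω + ((k : ℂ) * (ι ((βK ^ (N + 1) : 𝓞 K) : K) * Ω - Ω / ι ((π₀ ^ (N + 1) : 𝓞 K) : K)) + ub))) - (W.baseChange ℂ).b₂ / 12) - (W.baseChange ℂ).a₃) / 2)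
    (hXZ' : ∀ m : ℕ, ∀ N ≤ m, ∀ k : ℕ, ((XZ' m N k : ↥(E ⊔ ltField π m : IntermediateField F (AlgebraicClosure F))) : AlgebraicClosure F) = ιv (xZ' m N k))
    (hYZ' : ∀ m : ℕ, ∀ N ≤ m, ∀ k : ℕ, ((YZ' m N k : ↥(E ⊔ ltField π m : IntermediateField F (AlgebraicClosure F))) : AlgebraicClosure F) = ιv (yZ' m N k)) :
    ∃ a : 𝒪[F]ˣ,
      (∀ (m : ℕ) (h : (curveOver (E ⊔ ltField π m : IntermediateField F (AlgebraicClosure F))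
          ((W.map (Int.castRingHom ℤ_[2])).map ((LTCoeff.of F).toRingHom.comp e.symm.toRingHom))).toAffine.Nonsingular
          (XY m m) (YY m m)),
        ptOfZ (E ⊔ ltField π m : IntermediateField F (AlgebraicClosure F))
            ((W.map (Int.castRingHom ℤ_[2])).map ((LTCoeff.of F).toRingHom.comp e.symm.toRingHom))
            (evalPt₁ (maxNilIdeal F (E ⊔ ltField π m : IntermediateField F (AlgebraicClosure F)))
              (hom (isLTRing_LTCoeff hπ) (isLTSeries_map_LTCoeff_of_degree_one e hq heπ hP) (isLTSeries_LTCoeff π) 1)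
              (constantCoeff_hom _ _ _ 1)
              (evalPt₁ (maxNilIdeal F (E ⊔ ltField π m : IntermediateField F (AlgebraicClosure F)))
                (hom (isLTRing_LTCoeff hπ) (isLTSeries_LTCoeff π) (isLTSeries_LTCoeff π) (LTCoeff.of F (a : 𝒪[F])))
                (constantCoeff_hom _ _ _ _)
                (inclPt (le_sup_right : ltField π m ≤ E ⊔ ltField π m) (cohPt hπ m)))) =
          (.some (XY m m) (YY m m) h : (curveOver (E ⊔ ltField π m : IntermediateField F (AlgebraicClosure F))
            ((W.map (Int.castRingHom ℤ_[2])).map ((LTCoeff.of F).toRingHom.comp e.symm.toRingHom))).toAffine.Point)) ∧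
      ∀ i : J, relColemanSeries hπ E hq hE hσ₀ (β i) =
        PowerSeries.subst ((hom (isLTRing_LTCoeff hπ) (isLTSeries_LTCoeff _) (isLTSeries_LTCoeff _)
            (LTCoeff.of F (a : 𝒪[F]))).map
            (algebraMap (LTCoeff F) (unitBall E)))
          (PowerSeries.subst ((hom (isLTRing_LTCoeff hπ) (isLTSeries_map_LTCoeff_of_degree_one e hq heπ hP) (isLTSeries_LTCoeff _) 1).map
            (algebraMap (LTCoeff F) (unitBall E)))
            (PowerSeries.map ψ (C (Kc i) * ∏ c ∈ (S i).erase 0,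
              PowerSeries.invOfUnit (((W.map (Int.castRingHom R)).translateX x₀ y₀).subst (W.map (Int.castRingHom R)).formalNeg - C (x i c))
                (uc i c) ^ 6))) := by
  subst hW
  set W : WeierstrassCurve ℤ := ⟨1, -1, 0, -2, -1⟩ with hWdef
  -- the diagonal of the `Y`-family reads `ξ(u_{m+1})` at level `m`
  have hxu : ∀ m : ℕ, algClosureEmb ι (xY m m) =
      ℘[L] (ι ((βK ^ (m + 1) : 𝓞 K) : K) * Ω - Ω / ι ((π₀ ^ (m + 1) : 𝓞 K) : K)) - (W.baseChange ℂ).b₂ / 12 := fun m => hxY m m le_rfl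
  have hyu : ∀ m : ℕ, algClosureEmb ι (yY m m) = (℘'[L] (ι ((βK ^ (m + 1) : 𝓞 K) : K) * Ω - Ω / ι ((π₀ ^ (m + 1) : 𝓞 K) : K)) -
      (W.baseChange ℂ).a₁ * (℘[L] (ι ((βK ^ (m + 1) : 𝓞 K) : K) * Ω - Ω / ι ((π₀ ^ (m + 1) : 𝓞 K) : K)) - (W.baseChange ℂ).b₂ / 12) -
      (W.baseChange ℂ).a₃) / 2 := fun m => hyY m m le_rfl
  have hXU : ∀ m : ℕ, ((XY m m : ↥(E ⊔ ltField π m : IntermediateField F (AlgebraicClosure F))) : AlgebraicClosure F) =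
      ιv (xY m m) := fun m => hXY m m le_rfl
  have hYU : ∀ m : ℕ, ((YY m m : ↥(E ⊔ ltField π m : IntermediateField F (AlgebraicClosure F))) : AlgebraicClosure F) =
      ιv (yY m m) := fun m => hYY m m le_rfl
  -- `π₀ᵏ ∉ 𝔪` (else `2ᵏ = π₀ᵏπ₁ᵏ ∈ 𝔪`)
  have hπ₀𝔪 : ∀ k : ℕ, (π₀ ^ k : 𝓞 K) ∉ 𝔪 := fun k h => h𝔪2 k (by rw [h2K, mul_pow]; exact 𝔪.mul_mem_right _ h)
  -- abbreviations: the readings `ι_ℂ = ι̂`, `ι_v`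
  have hπ₀0 : π₀ ≠ 0 := hprime.ne_zero
  have hια : ∀ n : ℕ, ι ((π₀ ^ n : 𝓞 K) : K) ≠ 0 := fun n => (map_ne_zero ι).mpr (by exact_mod_cast pow_ne_zero n hπ₀0)
  -- (0) lattice bookkeeping: non-membership of the arguments
  have hΩL : Ω ∉ L.lattice := notMem_lattice_of_model ι hL hΩ h𝔪1
  have hπΩ : ι (π₀ : K) * Ω ∉ L.lattice := mul_gen_notMem ι hL hΩ (by simpa using hπ₀𝔪 1)
  have huL : ∀ n : ℕ, ι ((βK ^ (n + 1) : 𝓞 K) : K) * Ω - Ω / ι ((π₀ ^ (n + 1) : 𝓞 K) : K) ∉ L.lattice := fun n =>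
    divisionPt_succ_notMem ι hL hΩ h2K hprime hπ₁ n
  have hwL : ∀ n : ℕ, ι ((βK ^ n : 𝓞 K) : K) * Ω ∉ L.lattice := fun n => mul_pow_notMem_lattice_of_model ι hL hΩ h𝔪1 hβK n
  have hqL : ∀ n : ℕ, Ω / ι ((π₀ ^ (n + 1) : 𝓞 K) : K) ∉ L.lattice := fun n h => hΩL (by
    have h1 := isCMLattice_of_model ι hL (π₀ ^ (n + 1)) _ h
    have e1 : ι ((π₀ ^ (n + 1) : 𝓞 K) : K) * (Ω / ι ((π₀ ^ (n + 1) : 𝓞 K) : K)) = Ω := by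
      have h0 := hια (n + 1)
      field_simp
    rwa [e1] at h1)
  have hΩu : ∀ n : ℕ, Ω + (ι ((βK ^ (n + 2) : 𝓞 K) : K) * Ω - Ω / ι ((π₀ ^ (n + 2) : 𝓞 K) : K)) ∉ L.lattice := fun n =>
    add_divisionPt_notMem ι hL hΩ hβK hπ₀0 (hπ₀𝔪 (n + 2))
  have hπΩu : ∀ n : ℕ, ι (π₀ : K) * (Ω + (ι ((βK ^ (n + 2) : 𝓞 K) : K) * Ω - Ω / ι ((π₀ ^ (n + 2) : 𝓞 K) : K))) ∉ L.lattice :=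
    fun n => mul_add_divisionPt_succ_notMem ι hL hΩ hβK hπ₀0 (n := n + 1) (hπ₀𝔪 (n + 2))
  have hαu : ∀ m : ℕ, algClosureEmb ι (j αR) * (ι ((βK ^ (m + 2) : 𝓞 K) : K) * Ω - Ω / ι ((π₀ ^ (m + 2) : 𝓞 K) : K)) -
      (ι ((βK ^ (m + 1) : 𝓞 K) : K) * Ω - Ω / ι ((π₀ ^ (m + 1) : 𝓞 K) : K)) ∈ L.lattice := fun m => by
    rw [hαj]; exact mul_divisionPt_succ_sub_mem ι hL hβK hπ₀0 (m + 1)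
  -- the CM datum phrased with `α = ι̂ (j α_R)`
  have hT' : ∀ z : ℂ, z ∉ L.lattice → algClosureEmb ι (j αR) * z ∉ L.lattice →
      PC.eval (℘[L] z) = ℘[L] (algClosureEmb ι (j αR) * z) * QC.eval (℘[L] z) := by rw [hαj]; exact hT
  have hπΩ' : algClosureEmb ι (j αR) * Ω ∉ L.lattice := by rw [hαj]; exact hπΩ
  have hπΩu' : ∀ n : ℕ, algClosureEmb ι (j αR) * (Ω + (ι ((βK ^ (n + 2) : 𝓞 K) : K) * Ω - Ω / ι ((π₀ ^ (n + 2) : 𝓞 K) : K))) ∉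
      L.lattice := by rw [hαj]; exact hπΩu
  have hx₁' : algClosureEmb ι (j x₁) = ℘[L] (algClosureEmb ι (j αR) * Ω) - (W.baseChange ℂ).b₂ / 12 := by rw [hαj]; exact hx₁
  have hy₁' : algClosureEmb ι (j y₁) = (℘'[L] (algClosureEmb ι (j αR) * Ω) - (W.baseChange ℂ).a₁ * (℘[L] (algClosureEmb ι (j αR) * Ω) -
      (W.baseChange ℂ).b₂ / 12) - (W.baseChange ℂ).a₃) / 2 := by rw [hαj]; exact hy₁
  have hxz' : ∀ m : ℕ, algClosureEmb ι (xz m) = ℘[L] (algClosureEmb ι (j αR) * (Ω + (ι ((βK ^ (m + 2) : 𝓞 K) : K) * Ω -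
      Ω / ι ((π₀ ^ (m + 2) : 𝓞 K) : K)))) - (W.baseChange ℂ).b₂ / 12 := by rw [hαj]; exact hxz
  have hyz' : ∀ m : ℕ, algClosureEmb ι (yz m) = (℘'[L] (algClosureEmb ι (j αR) * (Ω + (ι ((βK ^ (m + 2) : 𝓞 K) : K) * Ω -
      Ω / ι ((π₀ ^ (m + 2) : 𝓞 K) : K)))) - (W.baseChange ℂ).a₁ * (℘[L] (algClosureEmb ι (j αR) * (Ω + (ι ((βK ^ (m + 2) : 𝓞 K) : K) * Ω -
      Ω / ι ((π₀ ^ (m + 2) : 𝓞 K) : K)))) - (W.baseChange ℂ).b₂ / 12) - (W.baseChange ℂ).a₃) / 2 := by rw [hαj]; exact hyz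
  have hQ : ∀ m : ℕ, QC.eval (℘[L] (Ω + (ι ((βK ^ (m + 2) : 𝓞 K) : K) * Ω - Ω / ι ((π₀ ^ (m + 2) : 𝓞 K) : K)))) ≠ 0 := fun m =>
    hQC _ (hΩu m) (hπΩu m)
  -- the two presentations share one integral model
  have hWR : (W.map (Int.castRingHom R)).map ψ =
      ((W.map (Int.castRingHom ℤ_[2])).map ((LTCoeff.of F).toRingHom.comp e.symm.toRingHom)).map
        (algebraMap (LTCoeff F) (unitBall E)) := by
    rw [WeierstrassCurve.map_map (W.map (Int.castRingHom ℤ_[2]))]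
    exact WeierstrassCurve.map_intCast_eq_map_intCast W _ _
  -- readings of `R`-points one level up
  have hread : ∀ (m : ℕ) (r : R), ((((inclUnitBall (F := F) (le_sup_left : E ≤ E ⊔ ltField π m) (ψ r) :
      unitBall (E ⊔ ltField π m : IntermediateField F (AlgebraicClosure F))) :
      (E ⊔ ltField π m : IntermediateField F (AlgebraicClosure F))) : AlgebraicClosure F)) =
      ιv (j r) := fun m r => by
    rw [coe_inclUnitBall, IntermediateField.coe_inclusion]; exact hψj r
  -- nonsingularity of the levelwise points
  have hnU : ∀ m : ℕ, (curveOver (E ⊔ ltField π m : IntermediateField F (AlgebraicClosure F))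
      ((W.map (Int.castRingHom ℤ_[2])).map ((LTCoeff.of F).toRingHom.comp e.symm.toRingHom))).toAffine.Nonsingular
      (XY m m) (YY m m) := fun m =>
    nonsingular_curveOver_of_readings e _ W (algClosureEmb ι) ιv L h₂ h₃ (huL m)
      (hxu m) (hyu m) (hXU m) (hYU m)
  have hnQ : ∀ m : ℕ, (curveOver (E ⊔ ltField π m : IntermediateField F (AlgebraicClosure F))
      ((W.map (Int.castRingHom ℤ_[2])).map ((LTCoeff.of F).toRingHom.comp e.symm.toRingHom))).toAffine.Nonsingular
      (XQ m) (YQ m) := fun m =>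
    nonsingular_curveOver_of_readings e _ W (algClosureEmb ι) ιv L h₂ h₃ (hqL m)
      (hxq m) (hyq m) (hXQ m) (hYQ m)
  have h0 : ∀ m : ℕ, (curveOver (E ⊔ ltField π m : IntermediateField F (AlgebraicClosure F))
      ((W.map (Int.castRingHom ℤ_[2])).map ((LTCoeff.of F).toRingHom.comp e.symm.toRingHom))).toAffine.Nonsingular
      (((inclUnitBall (F := F) (le_sup_left : E ≤ E ⊔ ltField π m) (ψ (τ^[m + 1] x₀)) :
        unitBall (E ⊔ ltField π m : IntermediateField F (AlgebraicClosure F))) :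
        (E ⊔ ltField π m : IntermediateField F (AlgebraicClosure F))))
      (((inclUnitBall (F := F) (le_sup_left : E ≤ E ⊔ ltField π m) (ψ (τ^[m + 1] y₀)) :
        unitBall (E ⊔ ltField π m : IntermediateField F (AlgebraicClosure F))) :
        (E ⊔ ltField π m : IntermediateField F (AlgebraicClosure F)))) := fun m =>
    nonsingular_curveOver_of_readings e _ W (algClosureEmb ι) ιv L h₂ h₃ (hwL (m + 1))
      (hτx₀ m) (hτy₀ m) (hread m _) (hread m _)
  -- the value identity «which is precisely `e_m(𝔞)`»
  have hc𝔣 : ∀ m : ℕ, Ideal.span {π₀ ^ (m + 1)} * 𝔪 ≠ ⊤ := fun m h => h𝔪1 (eq_top_iff.mpr (h ▸ Ideal.mul_le_left))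
  have hideal : ∀ m : ℕ, 𝔪 * v.asIdeal ^ (m + 1) = Ideal.span {π₀ ^ (m + 1)} * 𝔪 := fun m => by
    rw [hv0, Ideal.span_singleton_pow, mul_comm]
  have hθ : ∀ (i : J) (m : ℕ), IsThetaValueOne ι (Ideal.span {π₀ ^ (m + 1)} * 𝔪) (𝔞 i)
      (algClosureEmb ι ((xf i m : rayClassField K (𝔪 * v.asIdeal ^ (m + 1))) : AlgebraicClosure K)) := fun i m =>
    (congrArg (fun I : Ideal (𝓞 K) => IsThetaValueOne ι I (𝔞 i)
      (algClosureEmb ι ((xf i m : rayClassField K (𝔪 * v.asIdeal ^ (m + 1))) : AlgebraicClosure K))) (hideal m)).mp (hxf i m)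
  have hglob : ∀ (i : J) (m : ℕ), j (Kc i) * ∏ c ∈ (S i).erase 0, ((xq m - j (x i c))⁻¹) ^ 6 =
      ((xf i m : rayClassField K (𝔪 * v.asIdeal ^ (m + 1))) : AlgebraicClosure K) := fun i m =>
    thetaAlg_eq_of_isThetaValueOne ι hL hΩ (hLa i) (hS i) (pow_ne_zero _ hπ₀0) (hc𝔣 m) j (Kc i) (x i) ((W.baseChange ℂ).b₂ / 12) (hKj i)
      (hxj i) (hxq m) (hθ i m)
  -- characteristic zero of the levels
  haveI : CharZero 𝒪[F] := e.toRingHom.charZero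
  haveI : CharZero F := charZero_of_injective_algebraMap (R := 𝒪[F]) (A := F) Subtype.val_injective
  haveI : CharZero (AlgebraicClosure F) := charZero_of_injective_algebraMap (algebraMap F (AlgebraicClosure F)).injective
  have htwo : ∀ (M : IntermediateField F (AlgebraicClosure F)), (2 : M) ≠ 0 := fun M h => by
    have h1 := congrArg (algebraMap M (AlgebraicClosure F)) h
    rw [map_ofNat, map_zero] at h1
    exact two_ne_zero h1
  -- the `ℓ`-adic side of `2`: `‖2‖ < 1` in every level, `hTP` one level up
  have hTP' : ∀ m : ℕ, T.map ((inclUnitBall (F := F) (le_sup_left : E ≤ E ⊔ ltField π m)).toRingHom.comp ψ) =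
      (P.map ((LTCoeff.of F).toRingHom.comp e.symm.toRingHom)).map
        (algebraMap (LTCoeff F) (unitBall (E ⊔ ltField π m : IntermediateField F (AlgebraicClosure F)))) := fun m => by
    rw [PowerSeries.map_comp, RingHom.comp_apply, hTP, ← RingHom.comp_apply (PowerSeries.map _)
      (PowerSeries.map (algebraMap (LTCoeff F) (unitBall E))), ← PowerSeries.map_comp, AlgHom.toRingHom_eq_coe,
      inclUnitBall_comp_algebraMap]
  have hQ' : ∀ w : ℂ, w ∉ L.lattice → algClosureEmb ι (j αR) * w ∉ L.lattice → QC.eval (℘[L] w) ≠ 0 := by rw [hαj]; exact hQC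
  -- (N1) DISCHARGED: de Shalit's division points lie in the kernel of reduction (cf2-p1-w5's (N1)-PKG)
  have hU : ∀ m : ℕ, (.some (XY m m) (YY m m) (hnU m) : (curveOver (E ⊔ ltField π m : IntermediateField F (AlgebraicClosure F)) ((W.map (Int.castRingHom ℤ_[2])).map ((LTCoeff.of F).toRingHom.comp e.symm.toRingHom))).toAffine.Point) ∈
      kernel (NormedField.valuation (K := (E ⊔ ltField π m : IntermediateField F (AlgebraicClosure F)))) (curveOver (E ⊔ ltField π m : IntermediateField F (AlgebraicClosure F)) ((W.map (Int.castRingHom ℤ_[2])).map ((LTCoeff.of F).toRingHom.comp e.symm.toRingHom))) := fun m =>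
    some_mem_kernel_divisionPt_of_readings e hq hπ heπ hA hP hV hp hϖ (E ⊔ ltField π m : IntermediateField F (AlgebraicClosure F)) (algClosureEmb ι) ιv
      ((inclUnitBall (F := F) (le_sup_left : E ≤ E ⊔ ltField π m)).toRingHom.comp ψ) j (fun r => hread m r) L h₂ h₃ ι hL
      hT' hs hQr hPr hT0 (hTP' m) hidX hidY hΩ htr hβK h2K hprime hπ₁ h𝔪2 hub1 hub0 hαj rfl (valuation_two_lt_one hq hπ _) (htwo _)
      hQ' hx₀ hy₀ hx₁' hy₁' (xY m) (yY m) (XY m) (YY m) (hxY m) (hyY m) (hXY m) (hYY m) (xS m) (yS m) (XS m) (YS m) (hxS m) (hyS m)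
      (hXS m) (hYS m) (xW' m) (yW' m) (XW' m) (YW' m) (hxW' m) (hyW' m) (hXW' m) (hYW' m) (xZ' m) (yZ' m) (XZ' m) (YZ' m)
      (fun N hN k => by rw [hαj]; exact hxZ' m N hN k) (fun N hN k => by rw [hαj]; exact hyZ' m N hN k) (hXZ' m) (hYZ' m)
  -- (N2) the order `2^{m+1}`
  have hord : ∀ m : ℕ, addOrderOf (.some (XY m m) (YY m m) (hnU m) : (curveOver (E ⊔ ltField π m : IntermediateField F (AlgebraicClosure F)) ((W.map (Int.castRingHom ℤ_[2])).map ((LTCoeff.of F).toRingHom.comp e.symm.toRingHom))).toAffine.Point) = 2 ^ (m + 1) := fun m =>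
    (addOrderOf_some_curveOver_of_readings e _ W (algClosureEmb ι) ιv L h₂ h₃
      (huL m) (hxu m) (hyu m) (hXU m) (hYU m) (hnU m)).trans (addOrderOf_toPoint_divisionPt_succ ι hL hΩ hβK h2K hprime hπ₁ m)
  -- (N3) the `[π]`-coherence
  have hcoh : ∀ m : ℕ, ltSMul (maxNilIdeal F (E ⊔ ltField π (m + 1) : IntermediateField F (AlgebraicClosure F))) (isLTRing_LTCoeff hπ)
      (isLTSeries_map_LTCoeff_of_degree_one e hq heπ hP) (LTCoeff.of F π)
      (zPt (.some (XY (m + 1) (m + 1)) (YY (m + 1) (m + 1)) (hnU (m + 1)) : (curveOver (E ⊔ ltField π (m + 1) : IntermediateField F (AlgebraicClosure F)) ((W.map (Int.castRingHom ℤ_[2])).map ((LTCoeff.of F).toRingHom.comp e.symm.toRingHom))).toAffine.Point) (hU (m + 1))) =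
      inclPt (sup_le_sup_left (ltField_mono hπ (Nat.le_succ m)) E)
        (zPt (.some (XY m m) (YY m m) (hnU m) : (curveOver (E ⊔ ltField π m : IntermediateField F (AlgebraicClosure F)) ((W.map (Int.castRingHom ℤ_[2])).map ((LTCoeff.of F).toRingHom.comp e.symm.toRingHom))).toAffine.Point) (hU m)) := fun m =>
    ltSMul_zPt_eq_inclPt_zPt_of_readings e hq hπ heπ hA hP W hV hp hϖ _ _ (sup_le_sup_left (ltField_mono hπ (Nat.le_succ m)) E)
      (algClosureEmb ι) ιv
      ((inclUnitBall (F := F) (le_sup_left : E ≤ E ⊔ ltField π (m + 1))).toRingHom.comp ψ)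
      j (fun r => hread (m + 1) r) L h₂ h₃ hT' hs hQr hPr hT0 (hTP' (m + 1)) hidX hidY
      hΩL hπΩ' (huL m) (huL (m + 1)) (hΩu m) (hπΩu' m) (hαu m) (hQ m) hx₀ hy₀ hx₁' hy₁' (hxu m) (hyu m) (hxu (m + 1)) (hyu (m + 1))
      (hxw m) (hyw m) (hxz' m) (hyz' m) (hXU m) (hYU m) (hXU (m + 1)) (hYU (m + 1)) (hXW m) (hYW m) (hXZ m) (hYZ m) (hU m)
      (hU (m + 1)) (hord (m + 1)) (htwo _)
  -- ONE Tate unit from the shared torsion points (B10a), WITH its point property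
  obtain ⟨a, ha⟩ := exists_unit_forall_ptOfZ_hom_hom_cohPt_eq e hq hπ heπ hA hP hV hp hϖ E
    (fun m => (.some (XY m m) (YY m m) (hnU m) : (curveOver (E ⊔ ltField π m : IntermediateField F (AlgebraicClosure F)) ((W.map (Int.castRingHom ℤ_[2])).map ((LTCoeff.of F).toRingHom.comp e.symm.toRingHom))).toAffine.Point)) hU hord hcoh
  -- the parameter `t_m = h([a]_f ω_{m+1})` is non-zero: `P(t_m) = U_m` has order `2^{m+1} ≠ 1`
  have ht0 : ∀ m : ℕ, (((evalPt₁ (maxNilIdeal F (E ⊔ ltField π m : IntermediateField F (AlgebraicClosure F)))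
      (hom (isLTRing_LTCoeff hπ) (isLTSeries_map_LTCoeff_of_degree_one e hq heπ hP) (isLTSeries_LTCoeff π) 1)
      (constantCoeff_hom _ _ _ 1)
      (evalPt₁ (maxNilIdeal F (E ⊔ ltField π m : IntermediateField F (AlgebraicClosure F)))
        (hom (isLTRing_LTCoeff hπ) (isLTSeries_LTCoeff π) (isLTSeries_LTCoeff π) (LTCoeff.of F (a : 𝒪[F])))
        (constantCoeff_hom _ _ _ _)
        (inclPt (le_sup_right : ltField π m ≤ E ⊔ ltField π m) (cohPt hπ m))) :
      (maxNilIdeal F (E ⊔ ltField π m : IntermediateField F (AlgebraicClosure F))).toIdeal) :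
      unitBall (E ⊔ ltField π m : IntermediateField F (AlgebraicClosure F))) :
      (E ⊔ ltField π m : IntermediateField F (AlgebraicClosure F))) ≠ 0 := by
    intro m h0
    have h1 : (.some (XY m m) (YY m m) (hnU m) : (curveOver (E ⊔ ltField π m : IntermediateField F (AlgebraicClosure F)) ((W.map (Int.castRingHom ℤ_[2])).map ((LTCoeff.of F).toRingHom.comp e.symm.toRingHom))).toAffine.Point) = 0 := by
      rw [← ha m, ptOfZ_of_eq_zero h0]
    exact absurd h1 (Affine.Point.some_ne_zero _)
  refine ⟨a, fun m h => ha m, fun i => ?_⟩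
  -- per unit: V1+V2 with that `a` ((he′) at `t_m` through `ha`, (hval_i) the value identity «which is precisely e_m(𝔞)»)
  exact relColemanSeries_eq_subst_subst_of_semiconj hπ E hq hE hσ₀ (β i)
    (PowerSeries.map ψ (C (Kc i) * ∏ c ∈ (S i).erase 0,
      PowerSeries.invOfUnit (((W.map (Int.castRingHom R)).translateX x₀ y₀).subst (W.map (Int.castRingHom R)).formalNeg - C (x i c))
        (uc i c) ^ 6))
    (constantCoeff_hom _ _ _ 1) (constantCoeff_hom _ _ _ _) ((W.map (Int.castRingHom ℤ_[2])).map ((LTCoeff.of F).toRingHom.comp e.symm.toRingHom)) (fun m => hEll m) ψ (W.map (Int.castRingHom R)) hWR ((S i).erase 0)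
    (Kc i) x₀ y₀ (x i) (uc i) (hu i) rfl τ hτ (WeierstrassCurve.map_map_intCast W τ) (hKτ i) (eι i) (heT i) (hinj i) (hsurj i) (hxτ i)
    ht0 XQ YQ h0 hnQ
    (fun m _ => by
      rw [ha m]
      exact some_sub_some_eq_some_curveOver_of_readings e _ W (algClosureEmb ι) ιv L h₂ h₃
        (hqL m) (huL m) (hwL (m + 1)) (by ring) (hxq m) (hyq m) (hxu m) (hyu m) (hτx₀ m) (hτy₀ m) (hXQ m) (hYQ m) (hXU m) (hYU m)
        (hread m _) (hread m _) (hnQ m) (hnU m) (h0 m))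
    (fun m => thetaAlg_eq_of_map_eq (algebraMap (E ⊔ ltField π m : IntermediateField F (AlgebraicClosure F)) (AlgebraicClosure F)) ιv j ((S i).erase 0) (Kc i) (x i) (hglob i m)
      (hread m (Kc i)) (hXQ m) (fun c _ => hread m (x i c)) (hβv i m))

end Summit.BirchSwinnertonDyer.BirchSwinnertonDyer.Theorems.PrintCf2.KatzMeasureJZeroSeam

end
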